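import Summits.AtomisticToContinuum.FouriersLaw.Theorems.HiddenChargeMazurDressedChargeMainReductionAux1

/-!
# Main reduction for stub S1 of crux `DressedCharge` — helper 2: discrete Euler calculus

Crux stmt-AtomisticToContinuum-13509 (`HiddenChargeMazur.DressedCharge`), line `birth`, stub G
`stub_mainReduction` (lead). For a Liouville-type derivation `L = mkDerivation R h` of the lattice ring
`MvPolynomial (ℤ ⊕ ℤ) R` (`h (inl i) = p_i`, `h (inr i) = F_i(q)` a shift-equivariant nearest-neighbour
force) and the discrete Euler operators `E_p^S f = Σ_{k ∈ S} τ^{-k} ∂_{p_k} f`,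
`E_q^S f = Σ_{k ∈ S} τ^{-k} ∂_{q_k} f` (finite window `S`, written out as sums):
the commutators `[∂_{p_k}, L] = ∂_{q_k}`, `[∂_{q_k}, L] = Σ_i (∂_{q_k} F_i) ∂_{p_i}`, window
independence and shift re-indexing of the window sums, and the two Euler identities
`E_p(Lf) = E_q f + L E_p f`, `E_q(Lf) = L E_q f + Σ_{m ∈ {-1,0,1}} (∂_{q_0} F_m) · τ^m E_p f`.
No definitions, no notation.
-/

noncomputable section

namespace Summit.AtomisticToContinuum.FouriersLaw.Theorems.DressedCharge

open MvPolynomial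

variable {R : Type*} [CommRing R]

/-! ## Commutators of coordinate derivatives with a Liouville-type derivation -/

/-- `[∂_{p_k}, L] = ∂_{q_k}` when `L q_i = p_i` and `L p_i` is momentum-free. -/
theorem pderiv_inr_liouville (h : ℤ ⊕ ℤ → MvPolynomial (ℤ ⊕ ℤ) R)
    (hq : ∀ i, h (Sum.inl i) = X (Sum.inr i)) (hpure : ∀ i k, pderiv (Sum.inr k) (h (Sum.inr i)) = 0)
    (k : ℤ) (f : MvPolynomial (ℤ ⊕ ℤ) R) :
    pderiv (Sum.inr k) (MvPolynomial.mkDerivation R h f) =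
      MvPolynomial.mkDerivation R h (pderiv (Sum.inr k) f) + pderiv (Sum.inl k) f := by
  classical
  have key : ⁅(pderiv (Sum.inr k) : Derivation R (MvPolynomial (ℤ ⊕ ℤ) R) (MvPolynomial (ℤ ⊕ ℤ) R)),
      MvPolynomial.mkDerivation R h⁆ = pderiv (Sum.inl k) := by
    apply MvPolynomial.derivation_ext
    intro v
    rw [Derivation.commutator_apply, mkDerivation_X]
    rcases v with i | i
    · rw [hq]
      simp [Pi.single_apply, pderiv_X]
    · rw [hpure]
      simp [Pi.single_apply, pderiv_X, apply_ite]
  have := congrArg (fun δ : Derivation R (MvPolynomial (ℤ ⊕ ℤ) R) (MvPolynomial (ℤ ⊕ ℤ) R) => δ f) key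
  simp only [Derivation.commutator_apply] at this
  rw [← this]
  abel

/-- `[∂_{q_k}, L] = Σ_{i ∈ {k-1,k,k+1}} (∂_{q_k} F_i) ∂_{p_i}` for a nearest-neighbour force. -/
theorem pderiv_inl_liouville (h : ℤ ⊕ ℤ → MvPolynomial (ℤ ⊕ ℤ) R)
    (hq : ∀ i, h (Sum.inl i) = X (Sum.inr i))
    (hnn : ∀ i k, i ≠ k - 1 → i ≠ k → i ≠ k + 1 → pderiv (Sum.inl k) (h (Sum.inr i)) = 0)
    (k : ℤ) (f : MvPolynomial (ℤ ⊕ ℤ) R) :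
    pderiv (Sum.inl k) (MvPolynomial.mkDerivation R h f) =
      MvPolynomial.mkDerivation R h (pderiv (Sum.inl k) f) +
        (pderiv (Sum.inl k) (h (Sum.inr (k - 1))) * pderiv (Sum.inr (k - 1)) f +
          pderiv (Sum.inl k) (h (Sum.inr k)) * pderiv (Sum.inr k) f +
          pderiv (Sum.inl k) (h (Sum.inr (k + 1))) * pderiv (Sum.inr (k + 1)) f) := by
  classical
  let D' : Derivation R (MvPolynomial (ℤ ⊕ ℤ) R) (MvPolynomial (ℤ ⊕ ℤ) R) :=
    pderiv (Sum.inl k) (h (Sum.inr (k - 1))) • (pderiv (Sum.inr (k - 1)) : Derivation R _ _) +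
      pderiv (Sum.inl k) (h (Sum.inr k)) • (pderiv (Sum.inr k) : Derivation R _ _) +
      pderiv (Sum.inl k) (h (Sum.inr (k + 1))) • (pderiv (Sum.inr (k + 1)) : Derivation R _ _)
  have hD' : ∀ g, D' g = pderiv (Sum.inl k) (h (Sum.inr (k - 1))) * pderiv (Sum.inr (k - 1)) g +
      pderiv (Sum.inl k) (h (Sum.inr k)) * pderiv (Sum.inr k) g +
      pderiv (Sum.inl k) (h (Sum.inr (k + 1))) * pderiv (Sum.inr (k + 1)) g := fun g => by
    simp [D', Derivation.add_apply, Derivation.smul_apply, smul_eq_mul]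
  have e1 : (k - 1 ≠ k) := by omega
  have e2 : (k - 1 ≠ k + 1) := by omega
  have e3 : (k ≠ k + 1) := by omega
  have key : ⁅(pderiv (Sum.inl k) : Derivation R (MvPolynomial (ℤ ⊕ ℤ) R) (MvPolynomial (ℤ ⊕ ℤ) R)),
      MvPolynomial.mkDerivation R h⁆ = D' := by
    apply MvPolynomial.derivation_ext
    intro v
    rw [Derivation.commutator_apply, mkDerivation_X, hD']
    rcases v with i | i
    · rw [hq]
      simp [Pi.single_apply, pderiv_X, apply_ite]
    · by_cases h1 : i = k - 1
      · subst h1; simp [pderiv_X, e1, e2]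
      by_cases h2 : i = k
      · subst h2; simp [pderiv_X, e1.symm, e3]
      by_cases h3 : i = k + 1
      · subst h3; simp [pderiv_X, e2.symm, e3.symm]
      simp [pderiv_X, h1, h2, h3, hnn i k h1 h2 h3]
  have := congrArg (fun δ : Derivation R (MvPolynomial (ℤ ⊕ ℤ) R) (MvPolynomial (ℤ ⊕ ℤ) R) => δ f) key
  simp only [Derivation.commutator_apply] at this
  rw [hD'] at this
  rw [← this]
  abel

/-! ## Shifted coordinate derivatives -/

/-- `∂_{q_y} (τᵏ g) = τᵏ (∂_{q_{y-k}} g)`. -/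
theorem pderiv_inl_shift' (k y : ℤ) (g : MvPolynomial (ℤ ⊕ ℤ) R) :
    pderiv (Sum.inl y) (rename (Sum.map (fun i : ℤ => i + k) (fun i : ℤ => i + k)) g) =
      rename (Sum.map (fun i : ℤ => i + k) (fun i : ℤ => i + k)) (pderiv (Sum.inl (y - k)) g) := by
  have := pderiv_inl_shift k (y - k) g
  rwa [sub_add_cancel] at this

/-- `∂_{p_y} (τᵏ g) = τᵏ (∂_{p_{y-k}} g)`. -/
theorem pderiv_inr_shift' (k y : ℤ) (g : MvPolynomial (ℤ ⊕ ℤ) R) :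
    pderiv (Sum.inr y) (rename (Sum.map (fun i : ℤ => i + k) (fun i : ℤ => i + k)) g) =
      rename (Sum.map (fun i : ℤ => i + k) (fun i : ℤ => i + k)) (pderiv (Sum.inr (y - k)) g) := by
  have := pderiv_inr_shift k (y - k) g
  rwa [sub_add_cancel] at this

/-- `∂_{q_k} (τᵏ g) = τᵏ (∂_{q_0} g)`. -/
theorem pderiv_inl_shift_self (k : ℤ) (g : MvPolynomial (ℤ ⊕ ℤ) R) :
    pderiv (Sum.inl k) (rename (Sum.map (fun i : ℤ => i + k) (fun i : ℤ => i + k)) g) =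
      rename (Sum.map (fun i : ℤ => i + k) (fun i : ℤ => i + k)) (pderiv (Sum.inl 0) g) := by
  have := pderiv_inl_shift k 0 g
  rwa [zero_add] at this

/-- Shifts with equal offsets agree (index normalisation helper). -/
theorem shift_congr {j j' : ℤ} (hj : j = j') (f : MvPolynomial (ℤ ⊕ ℤ) R) :
    rename (Sum.map (fun i : ℤ => i + j) (fun i : ℤ => i + j)) f =
      rename (Sum.map (fun i : ℤ => i + j') (fun i : ℤ => i + j')) f := by
  subst hj; rfl

/-! ## Window sums: independence and re-indexing -/

/-- Window independence: in `Σ_{k ∈ S} Φ_k (∂_{ι k} f)` only the `k` with `ι k ∈ f.vars` matter. -/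
theorem window_sum_indep (ι : ℤ → ℤ ⊕ ℤ) (Φ : ℤ → MvPolynomial (ℤ ⊕ ℤ) R →ₐ[R] MvPolynomial (ℤ ⊕ ℤ) R)
    (S T : Finset ℤ) (f : MvPolynomial (ℤ ⊕ ℤ) R)
    (hS : ∀ k, ι k ∈ f.vars → k ∈ S) (hT : ∀ k, ι k ∈ f.vars → k ∈ T) :
    ∑ k ∈ S, Φ k (pderiv (ι k) f) = ∑ k ∈ T, Φ k (pderiv (ι k) f) := by
  classical
  have hzero : ∀ k, ι k ∉ f.vars → Φ k (pderiv (ι k) f) = 0 := fun k hk => by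
    rw [pderiv_eq_zero_of_notMem_vars hk, map_zero]
  have h1 : ∑ k ∈ S ∩ T, Φ k (pderiv (ι k) f) = ∑ k ∈ S, Φ k (pderiv (ι k) f) :=
    Finset.sum_subset Finset.inter_subset_left fun k hkS hknot =>
      hzero k fun hv => hknot (Finset.mem_inter.mpr ⟨hkS, hT k hv⟩)
  have h2 : ∑ k ∈ S ∩ T, Φ k (pderiv (ι k) f) = ∑ k ∈ T, Φ k (pderiv (ι k) f) :=
    Finset.sum_subset Finset.inter_subset_right fun k hkT hknot =>
      hzero k fun hv => hknot (Finset.mem_inter.mpr ⟨hS k hv, hkT⟩)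
  rw [← h1, h2]

/-- Re-indexing of the momentum Euler sum after a shift of the argument:
`Σ_{k∈S} τ^{-k} ∂_{p_k} (τʲ f) = Σ_{k ∈ S - j} τ^{-k} ∂_{p_k} f`. -/
theorem eulerP_sum_shift (S : Finset ℤ) (j : ℤ) (f : MvPolynomial (ℤ ⊕ ℤ) R) :
    ∑ k ∈ S, rename (Sum.map (fun i : ℤ => i + -k) (fun i : ℤ => i + -k))
        (pderiv (Sum.inr k) (rename (Sum.map (fun i : ℤ => i + j) (fun i : ℤ => i + j)) f)) =
      ∑ k ∈ S.image (fun k => k - j), rename (Sum.map (fun i : ℤ => i + -k) (fun i : ℤ => i + -k))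
        (pderiv (Sum.inr k) f) := by
  classical
  rw [Finset.sum_image (fun a _ b _ (hab : a - j = b - j) => by omega)]
  refine Finset.sum_congr rfl fun k _ => ?_
  rw [pderiv_inr_shift', shift_shift]
  exact shift_congr (by ring) _

/-- Re-indexing of the position Euler sum after a shift of the argument. -/
theorem eulerQ_sum_shift (S : Finset ℤ) (j : ℤ) (f : MvPolynomial (ℤ ⊕ ℤ) R) :
    ∑ k ∈ S, rename (Sum.map (fun i : ℤ => i + -k) (fun i : ℤ => i + -k))
        (pderiv (Sum.inl k) (rename (Sum.map (fun i : ℤ => i + j) (fun i : ℤ => i + j)) f)) =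
      ∑ k ∈ S.image (fun k => k - j), rename (Sum.map (fun i : ℤ => i + -k) (fun i : ℤ => i + -k))
        (pderiv (Sum.inl k) f) := by
  classical
  rw [Finset.sum_image (fun a _ b _ (hab : a - j = b - j) => by omega)]
  refine Finset.sum_congr rfl fun k _ => ?_
  rw [pderiv_inl_shift', shift_shift]
  exact shift_congr (by ring) _

/-- The momentum Euler sum intertwines a shift of the momentum index with a shift of the result:
`Σ_{k∈S} τ^{-k} ∂_{p_{k+m}} f = τᵐ Σ_{k∈S} τ^{-k} ∂_{p_k} f` (for windows with margin). -/
theorem eulerP_sum_index_shift (S : Finset ℤ) (m : ℤ) (f : MvPolynomial (ℤ ⊕ ℤ) R)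
    (hS : ∀ k, Sum.inr k ∈ f.vars → k ∈ S) (hSm : ∀ k, Sum.inr k ∈ f.vars → k - m ∈ S) :
    ∑ k ∈ S, rename (Sum.map (fun i : ℤ => i + -k) (fun i : ℤ => i + -k)) (pderiv (Sum.inr (k + m)) f) =
      rename (Sum.map (fun i : ℤ => i + m) (fun i : ℤ => i + m))
        (∑ k ∈ S, rename (Sum.map (fun i : ℤ => i + -k) (fun i : ℤ => i + -k)) (pderiv (Sum.inr k) f)) := by
  classical
  rw [map_sum]
  -- both sides are window sums of `G k := τ^{-(k-m)} ∂_{p_k} f`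
  have lhs : ∑ k ∈ S, rename (Sum.map (fun i : ℤ => i + -k) (fun i : ℤ => i + -k)) (pderiv (Sum.inr (k + m)) f) =
      ∑ k ∈ S.image (fun k => k + m), rename (Sum.map (fun i : ℤ => i + -(k - m)) (fun i : ℤ => i + -(k - m)))
        (pderiv (Sum.inr k) f) := by
    rw [Finset.sum_image (fun a _ b _ (hab : a + m = b + m) => by omega)]
    refine Finset.sum_congr rfl fun k _ => ?_
    exact shift_congr (by ring) _
  have rhs : ∑ k ∈ S, rename (Sum.map (fun i : ℤ => i + m) (fun i : ℤ => i + m))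
        (rename (Sum.map (fun i : ℤ => i + -k) (fun i : ℤ => i + -k)) (pderiv (Sum.inr k) f)) =
      ∑ k ∈ S, rename (Sum.map (fun i : ℤ => i + -(k - m)) (fun i : ℤ => i + -(k - m))) (pderiv (Sum.inr k) f) := by
    refine Finset.sum_congr rfl fun k _ => ?_
    rw [shift_shift]
    exact shift_congr (by ring) _
  rw [lhs, rhs]
  -- window independence for the family Φ k = τ^{-(k-m)}
  exact window_sum_indep Sum.inr (fun k => rename (Sum.map (fun i : ℤ => i + -(k - m)) (fun i : ℤ => i + -(k - m))))
    (S.image (fun k => k + m)) S f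
    (fun k hk => Finset.mem_image.mpr ⟨k - m, hSm k hk, by ring⟩) hS


/-! ## The two Euler identities -/

/-- **Momentum Euler identity** `E_p (L f) = E_q f + L (E_p f)` for a shift-equivariant Liouville-type
derivation with momentum-free force. -/
theorem eulerP_liouville (h : ℤ ⊕ ℤ → MvPolynomial (ℤ ⊕ ℤ) R)
    (hq : ∀ i, h (Sum.inl i) = X (Sum.inr i)) (hpure : ∀ i k, pderiv (Sum.inr k) (h (Sum.inr i)) = 0)
    (hequiv : ∀ (j : ℤ) (v : ℤ ⊕ ℤ), rename (Sum.map (fun i : ℤ => i + j) (fun i : ℤ => i + j)) (h v) =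
      h (Sum.map (fun i : ℤ => i + j) (fun i : ℤ => i + j) v))
    (S : Finset ℤ) (f : MvPolynomial (ℤ ⊕ ℤ) R) :
    ∑ k ∈ S, rename (Sum.map (fun i : ℤ => i + -k) (fun i : ℤ => i + -k))
        (pderiv (Sum.inr k) (MvPolynomial.mkDerivation R h f)) =
      ∑ k ∈ S, rename (Sum.map (fun i : ℤ => i + -k) (fun i : ℤ => i + -k)) (pderiv (Sum.inl k) f) +
        MvPolynomial.mkDerivation R h
          (∑ k ∈ S, rename (Sum.map (fun i : ℤ => i + -k) (fun i : ℤ => i + -k)) (pderiv (Sum.inr k) f)) := by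
  rw [map_sum, ← Finset.sum_add_distrib]
  refine Finset.sum_congr rfl fun k _ => ?_
  rw [pderiv_inr_liouville h hq hpure, map_add, add_comm,
    mkDerivation_rename_of_equivariant _ h (hequiv (-k))]

/-- **Position Euler identity** `E_q (L f) = L (E_q f) + Σ_{m ∈ {-1,0,1}} (∂_{q_0} F_m) · τᵐ (E_p f)` for a
shift-equivariant nearest-neighbour Liouville-type derivation (window with margin one around the
momentum support of `f`). -/
theorem eulerQ_liouville (h : ℤ ⊕ ℤ → MvPolynomial (ℤ ⊕ ℤ) R)
    (hq : ∀ i, h (Sum.inl i) = X (Sum.inr i))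
    (hnn : ∀ i k, i ≠ k - 1 → i ≠ k → i ≠ k + 1 → pderiv (Sum.inl k) (h (Sum.inr i)) = 0)
    (hequiv : ∀ (j : ℤ) (v : ℤ ⊕ ℤ), rename (Sum.map (fun i : ℤ => i + j) (fun i : ℤ => i + j)) (h v) =
      h (Sum.map (fun i : ℤ => i + j) (fun i : ℤ => i + j) v))
    (S : Finset ℤ) (f : MvPolynomial (ℤ ⊕ ℤ) R)
    (hS : ∀ k, Sum.inr k ∈ f.vars → k - 1 ∈ S ∧ k ∈ S ∧ k + 1 ∈ S) :
    ∑ k ∈ S, rename (Sum.map (fun i : ℤ => i + -k) (fun i : ℤ => i + -k))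
        (pderiv (Sum.inl k) (MvPolynomial.mkDerivation R h f)) =
      MvPolynomial.mkDerivation R h
          (∑ k ∈ S, rename (Sum.map (fun i : ℤ => i + -k) (fun i : ℤ => i + -k)) (pderiv (Sum.inl k) f)) +
        (pderiv (Sum.inl 0) (h (Sum.inr (-1))) *
            rename (Sum.map (fun i : ℤ => i + -1) (fun i : ℤ => i + -1))
              (∑ k ∈ S, rename (Sum.map (fun i : ℤ => i + -k) (fun i : ℤ => i + -k)) (pderiv (Sum.inr k) f)) +
          pderiv (Sum.inl 0) (h (Sum.inr 0)) *
              (∑ k ∈ S, rename (Sum.map (fun i : ℤ => i + -k) (fun i : ℤ => i + -k)) (pderiv (Sum.inr k) f)) +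
          pderiv (Sum.inl 0) (h (Sum.inr 1)) *
            rename (Sum.map (fun i : ℤ => i + 1) (fun i : ℤ => i + 1))
              (∑ k ∈ S, rename (Sum.map (fun i : ℤ => i + -k) (fun i : ℤ => i + -k)) (pderiv (Sum.inr k) f))) := by
  -- the anchored Hessian entries: `τ^{-k} ∂_{q_k} F_{k+m} = ∂_{q_0} F_m`
  have hW : ∀ k m : ℤ, rename (Sum.map (fun i : ℤ => i + -k) (fun i : ℤ => i + -k))
      (pderiv (Sum.inl k) (h (Sum.inr (k + m)))) = pderiv (Sum.inl 0) (h (Sum.inr m)) := by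
    intro k m
    have e : h (Sum.inr (k + m)) = rename (Sum.map (fun i : ℤ => i + k) (fun i : ℤ => i + k)) (h (Sum.inr m)) := by
      rw [hequiv k (Sum.inr m)]
      simp [add_comm]
    rw [e, pderiv_inl_shift_self, shift_neg_shift]
  -- the three shifted momentum sums
  have hS0 : ∀ k, Sum.inr k ∈ f.vars → k ∈ S := fun k hk => (hS k hk).2.1
  have hsum1 : ∑ k ∈ S, rename (Sum.map (fun i : ℤ => i + -k) (fun i : ℤ => i + -k)) (pderiv (Sum.inr (k + 1)) f) =
      rename (Sum.map (fun i : ℤ => i + 1) (fun i : ℤ => i + 1))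
        (∑ k ∈ S, rename (Sum.map (fun i : ℤ => i + -k) (fun i : ℤ => i + -k)) (pderiv (Sum.inr k) f)) :=
    eulerP_sum_index_shift S 1 f hS0 (fun k hk => (hS k hk).1)
  have hsumm1 : ∑ k ∈ S, rename (Sum.map (fun i : ℤ => i + -k) (fun i : ℤ => i + -k)) (pderiv (Sum.inr (k + -1)) f) =
      rename (Sum.map (fun i : ℤ => i + -1) (fun i : ℤ => i + -1))
        (∑ k ∈ S, rename (Sum.map (fun i : ℤ => i + -k) (fun i : ℤ => i + -k)) (pderiv (Sum.inr k) f)) :=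
    eulerP_sum_index_shift S (-1) f hS0 (fun k hk => by have := (hS k hk).2.2; rwa [sub_neg_eq_add])
  -- termwise commutator, then regroup
  have hterm : ∀ k ∈ S, rename (Sum.map (fun i : ℤ => i + -k) (fun i : ℤ => i + -k))
      (pderiv (Sum.inl k) (MvPolynomial.mkDerivation R h f)) =
      MvPolynomial.mkDerivation R h (rename (Sum.map (fun i : ℤ => i + -k) (fun i : ℤ => i + -k)) (pderiv (Sum.inl k) f)) +
        (pderiv (Sum.inl 0) (h (Sum.inr (-1))) *
            rename (Sum.map (fun i : ℤ => i + -k) (fun i : ℤ => i + -k)) (pderiv (Sum.inr (k + -1)) f) +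
          pderiv (Sum.inl 0) (h (Sum.inr 0)) *
            rename (Sum.map (fun i : ℤ => i + -k) (fun i : ℤ => i + -k)) (pderiv (Sum.inr k) f) +
          pderiv (Sum.inl 0) (h (Sum.inr 1)) *
            rename (Sum.map (fun i : ℤ => i + -k) (fun i : ℤ => i + -k)) (pderiv (Sum.inr (k + 1)) f)) := by
    intro k _
    rw [pderiv_inl_liouville h hq hnn, map_add, mkDerivation_rename_of_equivariant _ h (hequiv (-k))]
    congr 1
    simp only [map_add, map_mul]
    have w1 := hW k (-1)
    have w0 := hW k 0
    have w2 := hW k 1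
    rw [add_zero] at w0
    rw [← sub_eq_add_neg] at w1
    rw [w1, w0, w2, sub_eq_add_neg]
  rw [Finset.sum_congr rfl hterm, Finset.sum_add_distrib, ← map_sum, Finset.sum_add_distrib,
    Finset.sum_add_distrib, ← Finset.mul_sum, ← Finset.mul_sum, ← Finset.mul_sum, hsum1, hsumm1]


/-- ANCHOR of this helper file (registered sub-goal of the crux): a shift by `k` turns `∂_{q_k}` into `∂_{q_0}`
on real lattice polynomials. -/
theorem mainReduction_pderiv_shift_anchor_real :
    ∀ (k : ℤ) (g : MvPolynomial (ℤ ⊕ ℤ) ℝ), MvPolynomial.pderiv (Sum.inl k) (MvPolynomial.rename (Sum.map (fun i : ℤ => i + k) (fun i : ℤ => i + k)) g) = MvPolynomial.rename (Sum.map (fun i : ℤ => i + k) (fun i : ℤ => i + k)) (MvPolynomial.pderiv (Sum.inl 0) g) :=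
  fun k g => pderiv_inl_shift_self k g

end Summit.AtomisticToContinuum.FouriersLaw.Theorems.DressedCharge

end
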